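import Literature.Geometry.Riemannian.HeatKernelGaussianIntegralBound
import Literature.Geometry.Riemannian.RicciFlowMetricFlow
import Literature.Geometry.Riemannian.RicciFlowThroughSingularitiesFour
import HarnessLib

/-!
# Bamler's Gaussian integral bound at an `H_n`-centre, in metric-flow language
# (Bamler 2020a, Thm. 3.12, for the metric flow of a compact Ricci flow)

R. Bamler, *Entropy and heat kernel bounds on a Ricci flow background*, arXiv:2008.07093 (2020a),
§3.1, Thm. 3.12 (arXiv v1: Thm. 13): "If `(z,t)` is an `H_n`-center of `(x₀,t₀)`, then for all
`r ≥ 0` and `ε > 0`,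
`ν_{x₀,t₀;t}(M ∖ B(z,t,r)) ≤ 2 exp(−(r − √(2H_n(t₀−t)))₊² / (8(t₀−t)))`."

`HeatKernelGaussianIntegralBound.lean` proves this for the heat kernel measures of a Ricci flow on a
closed manifold with the `H_n`-centre condition spelled out as `∫ d_t²(z,·) dν ≤ H_n(t₀ − t)`
(`heatKernelMeasure_real_setOf_le_edist_le`). This file restates it for the METRIC FLOW of the
Ricci flow (`ricciFlowMetricFlow`, Bamler 2023, §3.7) and Bamler's `H`-centres
(`MetricFlow.IsHCenter`, with `H = H_m = MetricFlow.concentrationConst m`): the bridge is the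
definitional identities `condKernel x s = ν_{x,t;s}` and `edist = d_{g_s}` of `ricciFlowMetricFlow`
and `IsHCenter.lintegral_edist_sq_le`.

## References

* R. H. Bamler, *Entropy and heat kernel bounds on a Ricci flow background*, arXiv:2008.07093
  (2020), §3.1, Def. 3.10, Prop. 3.11, Thm. 3.12. [Bamler2020Entropy]
* R. H. Bamler, *Compactness theory of the space of super Ricci flows*, Invent. Math. 233 (2023),
  §3.4 (`H`-centers), §3.7 (the metric flow of a Ricci flow). [Bamler2023]
-/

noncomputable section

open Set Filter Function MeasureTheory
open scoped Manifold ContDiff Topology ENNReal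

namespace Literature.Geometry.Riemannian

open Lorentzian Lorentzian.PseudoRiemannianMetric

universe u

variable {m : ℕ} {H : Type*} [TopologicalSpace H]
  {I : ModelWithCorners ℝ (EuclideanSpace ℝ (Fin m)) H} [I.Boundaryless]
  {M : Type u} [TopologicalSpace M] [ChartedSpace H M] [IsManifold I ∞ M]
  [T2Space M] [CompactSpace M] [SecondCountableTopology M] [MeasurableSpace M] [BorelSpace M]
  [ConnectedSpace M]
  {h : ℝ → PseudoRiemannianMetric I ∞ (EuclideanSpace ℝ (Fin m)) (TangentSpace I : M → Type _)}
  {cov : ℝ → CovariantDerivative I (EuclideanSpace ℝ (Fin m)) (TangentSpace I : M → Type _)}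
  {a T : ℝ} (hflow : IsRicciFlow h cov (Icc a T)) (hh : IsContMDiffFamilyOn ∞ h univ)
  (hR : ∀ r, (h r).IsRiemannian)

/-- **Bamler 2020a, Thm. 3.12, for the metric flow of a compact Ricci flow.** Let `hflow = (h, cov)`
be a Ricci flow on `[a, T]` of a `C^∞` family of Riemannian metrics on a closed connected manifold
modelled on `ℝᵐ`, `𝒳` its metric flow (`ricciFlowMetricFlow`), `s < t` times in `[a, T]` with
`a < s`, and `z ∈ 𝒳_s = M` an `H_m`-centre of `x ∈ 𝒳_t = M` (`H_m = (m−1)π²/2 + 4`). Then for every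
`r ≥ 0`,

  `ν_{x,t;s}({y | d_s(z, y) ≥ r}) ≤ 2 exp( −(r − √(2 H_m (t − s)))₊² / (8 (t − s)) )`.

[cite: Bamler2020Entropy, §3.1, Thm. 3.12 (arXiv v1 Thm. 13)] -/
theorem heatKernelMeasure_real_setOf_le_edist_le_of_isHCenter {s t : Icc a T} (has : a < (s : ℝ))
    (hst : (s : ℝ) < t) {x z : M}
    (hz : (ricciFlowMetricFlow hh hR Set.ordConnected_Icc hflow).IsHCenter
      (MetricFlow.concentrationConst m) (s := s) (t := t) z x) {r : ℝ} (hr : 0 ≤ r) :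
    (heatKernelMeasure hh hR t x s).real {y | ENNReal.ofReal r ≤ (h s).edist (hR s) z y} ≤
      2 * Real.exp
        (-(max (r - Real.sqrt (2 * (MetricFlow.concentrationConst m * ((t : ℝ) - s)))) 0) ^ 2
          / (8 * ((t : ℝ) - s))) := by
  have hvar : ∫⁻ y, (h s).edist (hR s) z y ^ 2 ∂(heatKernelMeasure hh hR t x s) ≤
      ENNReal.ofReal (MetricFlow.concentrationConst m * ((t : ℝ) - s)) :=
    hz.lintegral_edist_sq_le
  -- the slice distance of the metric flow is `d_{g_s}` and `condKernel x s = ν_{x,t;s}`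
  have hvar' : ∫⁻ y, (h s).edist (hR s) z y ^ 2 ∂(heatKernelMeasure hh hR t x s) ≤
      ENNReal.ofReal ((((m : ℝ) - 1) * Real.pi ^ 2 / 2 + 4) * ((t : ℝ) - s)) := by
    simpa [MetricFlow.concentrationConst] using hvar
  have hmain := heatKernelMeasure_real_setOf_le_edist_le hflow hh hR has hst t.2.2 x z hvar' r hr
  simpa [MetricFlow.concentrationConst] using hmain

end Literature.Geometry.Riemannian

end
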